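import Literature.Geometry.Kaehler.RiemannSurfaceGaloisClosure
import HarnessLib

/-!
# The holomorphic lifting criterion for unramified coverings of compact Riemann surfaces (Hatcher 1.33–1.34, Forster 4.6)

Topic `Literature/Geometry/Kaehler` — sequel of `RiemannSurfaceGaloisClosure` §1–§2 (an unramified holomorphic covering
map `q : Y → N` of compact connected Riemann surfaces is a local biholomorphism, so continuous maps over it from Riemann
surfaces are holomorphic), over Mathlib's lifting criterion `IsCoveringMap.existsUnique_continuousMap_lifts_of_range_le`
(Hatcher Prop. 1.33) and unique lifting `IsCoveringMap.eq_of_comp_eq` (Prop. 1.34).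

Setting: `q : Y → N` an unramified holomorphic covering of compact connected Riemann surfaces; `M` a CONNECTED space
charted over `ℂ` (e.g. any connected Riemann surface, compact or not), `φ : M → N` holomorphic, `m : M`, `e ∈ Y` with
`q e = φ m`.

## What is proved (everything; no definitions, no instances, no named facts)

* §1 **`exists_mdifferentiable_lift_iff_range_le`** — a HOLOMORPHIC lift `φ̃ : M → Y`, `q ∘ φ̃ = φ`, `φ̃ m = e`, exists
  iff `φ_* π₁(M, m) ≤ q_* π₁(Y, e)`; it is unique (`lift_unique_of_isCoveringMap`, Prop. 1.34); `range_map_le_of_lift` (necessity);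
* §2 **`exists_mdifferentiable_lift_of_simplyConnectedSpace`** — from a simply connected `M` every holomorphic map lifts
  holomorphically to every unramified covering, through any prescribed point of the fibre; in particular from a compact
  Riemann surface of genus `0` (`exists_mdifferentiable_lift_of_arithGenus_eq_zero`);
* §3 **`exists_mdifferentiable_lift_comp_iff`** — lifting holomorphic self-maps `ψ : N → N` (e.g. automorphisms) to
  `Y`: a holomorphic `ψ̃ : Y → Y` with `q ∘ ψ̃ = ψ ∘ q` and `ψ̃ e = e'` exists iff `(ψ ∘ q)_* π₁(Y, e) ≤ q_* π₁(Y, e')`.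

## References
* A. Hatcher, *Algebraic Topology*, CUP 2002, §1.3 Prop. 1.33 (p. 61), Prop. 1.34 (p. 62). [HatcherAT2002]
* O. Forster, *Lectures on Riemann Surfaces*, GTM 81, Springer 1981, §4 Thm. 4.6 («lifts of holomorphic maps along
  unbranched holomorphic coverings are holomorphic»). [Forster1981]
* H. M. Farkas, I. Kra, *Riemann Surfaces*, 2nd ed., GTM 71, Springer 1992, IV.6.1, IV.6.3. [FarkasKra1992]
-/

noncomputable section

open Set Function Filter TopologicalSpace
open _root_.Topology
open scoped Manifold ContDiff

namespace Literature.Geometry.Kaehler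

open Literature.Topology.CoveringSpaces

namespace RiemannSurface

universe u v w

variable {N : Type u} [TopologicalSpace N] [ChartedSpace ℂ N] [ConnectedSpace N] [IsManifold 𝓘(ℂ, ℂ) ω N]
  [CompactSpace N] [T2Space N]
  {Y : Type v} [TopologicalSpace Y] [ChartedSpace ℂ Y] [ConnectedSpace Y] [IsManifold 𝓘(ℂ, ℂ) ω Y]
  [CompactSpace Y] [T2Space Y]
  {q : Y → N} (hq : MDifferentiable 𝓘(ℂ, ℂ) 𝓘(ℂ, ℂ) q) (hc : IsCoveringMap q)
  {M : Type w} [TopologicalSpace M] [ChartedSpace ℂ M] [ConnectedSpace M]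
  {φ : M → N} (hφ : MDifferentiable 𝓘(ℂ, ℂ) 𝓘(ℂ, ℂ) φ)

/-! ### §1 The holomorphic lifting criterion -/

include hc in
omit [ConnectedSpace N] [IsManifold 𝓘(ℂ, ℂ) ω N] [CompactSpace N] [T2Space N] [ChartedSpace ℂ Y] [ConnectedSpace Y]
  [IsManifold 𝓘(ℂ, ℂ) ω Y] [CompactSpace Y] [T2Space Y] [ConnectedSpace M] in
/-- **Necessity**: a continuous lift `φ̃` of `φ` through `q` with `φ̃ m = e` forces `φ_* π₁(M, m) ≤ q_* π₁(Y, e)`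
(`φ_* = q_* ∘ φ̃_*`). [cite: HatcherAT2002, §1.3 Prop. 1.33 (p. 61)] -/
theorem range_map_le_of_lift {m : M} {e : Y} (he : q e = φ m) {φt : M → Y} (hφt : Continuous φt)
    (hlift : ∀ x, q (φt x) = φ x) (hm : φt m = e) :
    (FundamentalGroup.map (⟨φ, hφ.continuous⟩ : C(M, N)) m).range ≤
      (FundamentalGroup.mapOfEq (⟨q, hc.continuous⟩ : C(Y, N)) he).range := by
  rintro _ ⟨γ, rfl⟩
  refine ⟨FundamentalGroup.mapOfEq (⟨φt, hφt⟩ : C(M, Y)) hm γ, ?_⟩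
  have hcomp : (⟨q, hc.continuous⟩ : C(Y, N)).comp (⟨φt, hφt⟩ : C(M, Y)) = ⟨φ, hφ.continuous⟩ :=
    ContinuousMap.ext hlift
  rw [← Literature.AlgebraicTopology.FundamentalGroup.mapOfEq_comp_apply ⟨φt, hφt⟩ ⟨q, hc.continuous⟩ hm he]
  -- transport along the equality of continuous maps `q ∘ φ̃ = φ`
  have key : ∀ {k : C(M, N)} (_ : k = ⟨φ, hφ.continuous⟩) (h : k m = φ m),
      FundamentalGroup.mapOfEq k h γ = FundamentalGroup.map (⟨φ, hφ.continuous⟩ : C(M, N)) m γ := by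
    rintro k rfl h
    exact Literature.AlgebraicTopology.FundamentalGroup.mapOfEq_rfl_apply _ _ γ
  exact key hcomp _

include hq hc hφ in
omit [CompactSpace N] [T2Space Y] in
/-- **The holomorphic lifting criterion** (Hatcher 1.33 + Forster 4.6): for an unramified holomorphic covering
`q : Y → N` of compact connected Riemann surfaces, a holomorphic `φ : M → N` from a connected Riemann surface, `m : M`
and `e` over `φ m`, there is a HOLOMORPHIC `φ̃ : M → Y` with `q ∘ φ̃ = φ` and `φ̃ m = e` iff
`φ_* π₁(M, m) ≤ q_* π₁(Y, e)`. [cite: HatcherAT2002, §1.3 Prop. 1.33 (p. 61)] [cite: Forster1981, §4 Thm. 4.6] -/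
theorem exists_mdifferentiable_lift_iff_range_le {m : M} {e : Y} (he : q e = φ m) :
    (∃ φt : M → Y, MDifferentiable 𝓘(ℂ, ℂ) 𝓘(ℂ, ℂ) φt ∧ (∀ x, q (φt x) = φ x) ∧ φt m = e) ↔
      (FundamentalGroup.map (⟨φ, hφ.continuous⟩ : C(M, N)) m).range ≤
        (FundamentalGroup.mapOfEq (⟨q, hc.continuous⟩ : C(Y, N)) he).range := by
  constructor
  · rintro ⟨φt, hφt, hlift, hm⟩
    exact range_map_le_of_lift hc hφ he hφt.continuous hlift hm
  · intro hle
    haveI := pathConnectedSpace_of_connectedSpace M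
    haveI := ChartedSpace.locallyPathConnectedSpace ℂ M
    obtain ⟨Φ, ⟨hΦm, hΦ⟩, -⟩ :=
      hc.existsUnique_continuousMap_lifts_of_range_le (f := ⟨φ, hφ.continuous⟩) (a₀ := m) (e₀ := e) he hle
    have hlift : ∀ x, q (Φ x) = φ x := fun x ↦ congrFun hΦ x
    exact ⟨Φ, mdifferentiable_of_comp_eq_of_isCoveringMap hq hc hφ Φ.continuous hlift, hlift, hΦm⟩

include hc in
omit [ChartedSpace ℂ N] [ConnectedSpace N] [IsManifold 𝓘(ℂ, ℂ) ω N] [CompactSpace N] [T2Space N] [ChartedSpace ℂ Y]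
  [ConnectedSpace Y] [IsManifold 𝓘(ℂ, ℂ) ω Y] [CompactSpace Y] [T2Space Y] [ChartedSpace ℂ M] in
/-- **Uniqueness of lifts** (Hatcher 1.34): two continuous lifts of `φ` through `q` from the connected `M` agreeing
at one point are equal. [cite: HatcherAT2002, §1.3 Prop. 1.34 (p. 62)] -/
theorem lift_unique_of_isCoveringMap {φ₁ φ₂ : M → Y} (h₁ : Continuous φ₁) (h₂ : Continuous φ₂) (hl₁ : ∀ x, q (φ₁ x) = φ x)
    (hl₂ : ∀ x, q (φ₂ x) = φ x) {m : M} (hm : φ₁ m = φ₂ m) : φ₁ = φ₂ :=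
  haveI := (inferInstance : ConnectedSpace M).toPreconnectedSpace
  hc.eq_of_comp_eq h₁ h₂ (funext fun x ↦ (hl₁ x).trans (hl₂ x).symm) m hm

/-! ### §2 Simply connected sources -/

include hq hc hφ in
omit [CompactSpace N] [T2Space Y] in
/-- **Holomorphic maps from a simply connected Riemann surface lift holomorphically to every unramified covering**,
through any prescribed point of the fibre (`φ_* π₁(M) = 1`). [cite: HatcherAT2002, §1.3 Prop. 1.33 (p. 61)]
[cite: Forster1981, §4 Thm. 4.6] -/
theorem exists_mdifferentiable_lift_of_simplyConnectedSpace [SimplyConnectedSpace M] {m : M} {e : Y}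
    (he : q e = φ m) :
    ∃ φt : M → Y, MDifferentiable 𝓘(ℂ, ℂ) 𝓘(ℂ, ℂ) φt ∧ (∀ x, q (φt x) = φ x) ∧ φt m = e := by
  refine (exists_mdifferentiable_lift_iff_range_le hq hc hφ he).2 ?_
  rintro _ ⟨γ, rfl⟩
  rw [Subsingleton.elim γ 1, map_one]
  exact one_mem _

include hq hc in
omit [CompactSpace N] [T2Space Y] in
/-- In particular **holomorphic maps from a compact Riemann surface of genus `0` lift** holomorphically to every
unramified covering of the target (genus `0` ⇔ simply connected, Farkas–Kra IV.6.1 (a)).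
[cite: FarkasKra1992, IV.6.1 Theorem (a), IV.6.3] [cite: HatcherAT2002, §1.3 Prop. 1.33] -/
theorem exists_mdifferentiable_lift_of_arithGenus_eq_zero {P : Type w} [TopologicalSpace P] [ChartedSpace ℂ P]
    [ConnectedSpace P] [IsManifold 𝓘(ℂ, ℂ) ω P] [CompactSpace P] [T2Space P] (h0 : arithGenus P = 0)
    {ψ : P → N} (hψ : MDifferentiable 𝓘(ℂ, ℂ) 𝓘(ℂ, ℂ) ψ) {m : P} {e : Y} (he : q e = ψ m) :
    ∃ ψt : P → Y, MDifferentiable 𝓘(ℂ, ℂ) 𝓘(ℂ, ℂ) ψt ∧ (∀ x, q (ψt x) = ψ x) ∧ ψt m = e := by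
  haveI := simplyConnectedSpace_iff_arithGenus_eq_zero.2 h0
  exact exists_mdifferentiable_lift_of_simplyConnectedSpace hq hc hψ he

/-! ### §3 Lifting holomorphic self-maps of the base -/

include hq hc in
omit [CompactSpace N] [T2Space Y] in
/-- **Lifting holomorphic self-maps of `N` to the covering**: for a holomorphic `ψ : N → N` (e.g. a conformal
automorphism) and points `e, e'` of `Y` with `q e' = ψ (q e)`, there is a holomorphic `ψ̃ : Y → Y` with
`q ∘ ψ̃ = ψ ∘ q` and `ψ̃ e = e'` iff `(ψ ∘ q)_* π₁(Y, e) ≤ q_* π₁(Y, e')` (the criterion for `φ = ψ ∘ q`).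
[cite: HatcherAT2002, §1.3 Prop. 1.33 (p. 61)] [cite: Forster1981, §4 Thm. 4.6] -/
theorem exists_mdifferentiable_lift_comp_iff {ψ : N → N} (hψ : MDifferentiable 𝓘(ℂ, ℂ) 𝓘(ℂ, ℂ) ψ) {e e' : Y}
    (he : q e' = ψ (q e)) :
    (∃ ψt : Y → Y, MDifferentiable 𝓘(ℂ, ℂ) 𝓘(ℂ, ℂ) ψt ∧ (∀ y, q (ψt y) = ψ (q y)) ∧ ψt e = e') ↔
      (FundamentalGroup.map (⟨ψ ∘ q, (hψ.comp hq).continuous⟩ : C(Y, N)) e).range ≤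
        (FundamentalGroup.mapOfEq (⟨q, hc.continuous⟩ : C(Y, N)) he).range :=
  exists_mdifferentiable_lift_iff_range_le hq hc (hψ.comp hq) he

end RiemannSurface

end Literature.Geometry.Kaehler

end
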